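import Mathlib
import Literature.Geometry.DiscreteGeometry.DelaunaySubdivision
import Literature.Geometry.DiscreteGeometry.SolidAngleFraction
import Summits.AtomisticToContinuum.Crystallization.Theorems.ReggeStarCoercivitySolidAngleFlatness
import HarnessLib

/-!
# SquareWellLayerCake · `AveragedTwelve` — solid-angle partition of unity in complex form
(stub `stub_vertexFlat`)

Stub `stub_vertexFlat` of line `Sketch` (idea `par-five-delaunay-recount`) of crux
`SquareWellLayerCake.AveragedTwelve` (item stmt-AtomisticToContinuum-15806), route
`AtomisticToContinuum/Crystallization/SquareWellLayerCake`.

SOLID-ANGLE PARTITION OF UNITY IN COMPLEX FORM: let `K` be a triangulation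
(`Literature.Geometry.DiscreteGeometry.IsTriangulation`) of a finite set of sites `ω ⊂ ℝ³`, let
`v ∈ ω` be interior to `conv ω`, and let `S` be the set of cells of `K` through `v` (simplices of
`K` with `4` vertices containing `v`, i.e. the vertex star `vertexStar K v`).  Then the unit-ball
volume fractions at `v` of the apex cones `{v + ∑ c_w (w − v) : c_w ≥ 0}` (`w ∈ t ∖ {v}`) of the
cells `t ∈ S` sum to `1`.

## Proof

Pure plumbing of the landed item `SolidAngleFlatness`
(`Summit.AtomisticToContinuum.Crystallization.Theorems.solidAngleFlatness_proof`, stated for a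
family `p : Fin n → Fin 3 → ℝ³` of tetrahedra `conv(v, p k 0, p k 1, p k 2)`), with the tree's star
data of `Literature/Geometry/DiscreteGeometry/DelaunaySubdivision.lean`:

* enumerate `S ≃ Fin n` (`Finset.equivFin`) and, for each cell `t`, its three other vertices
  `t ∖ {v} ≃ Fin 3` (`Finset.equivFinOfCardEq`; `exists_fin_enum`), so that
  `insert v (range (p k)) = t_k`; reindexing the generators by an equivalence does not change the
  apex cone (`apexCone_comp_equiv`), so the summands agree;
* linear independence of the edge vectors: `linearIndependent_sub_of_mem_faces`;
* distinct cells of the star have disjoint interiors: `disjoint_interior_of_mem_vertexStar`;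
* the star covers a ball about the interior site `v`:
  `IsTriangulation.exists_ball_subset_biUnion_vertexStar`;
* `vertexStar K v = S` because `finrank ℝ ℝ³ + 1 = 4` (`finrank_euclideanSpace_fin`).

The equality conjunct of `solidAngleFlatness_proof` is then transported back from `Fin n` to `S`
(`Fintype.sum_equiv`, `Finset.sum_coe_sort`).  No named facts.
-/

noncomputable section

namespace Summit.AtomisticToContinuum.Crystallization.Theorems.ParFiveRecountVertexFlat

open MeasureTheory Metric Set
open Literature.Geometry.DiscreteGeometry

/-- Reindexing the generators by an equivalence does not change the apex cone. [folklore] -/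
theorem apexCone_comp_equiv {V : Type*} [AddCommGroup V] [Module ℝ V] {ι ι' : Type*}
    [Fintype ι] [Fintype ι'] (v : V) (u : ι → V) (e : ι' ≃ ι) :
    apexCone v (u ∘ e) = apexCone v u := by
  ext q
  simp only [mem_apexCone_iff, Function.comp_apply]
  constructor
  · rintro ⟨c, hc, rfl⟩
    refine ⟨c ∘ e.symm, fun i => hc _, ?_⟩
    rw [← Equiv.sum_comp e (fun i => (c ∘ e.symm) i • u i)]
    simp only [Function.comp_apply, Equiv.symm_apply_apply]
  · rintro ⟨c, hc, rfl⟩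
    refine ⟨c ∘ e, fun i => hc _, ?_⟩
    rw [← Equiv.sum_comp e (fun i => c i • u i)]
    simp only [Function.comp_apply]

/-- Enumerating the three other vertices of a `4`-point set `t ∋ v` by `Fin 3`: there is
`p : Fin 3 → ℝ³` with `insert v (range p) = t`, whose apex cone at `v` is the apex cone of the
edge vectors `w − v`, `w ∈ t ∖ {v}`, and which inherits their linear independence. [folklore] -/
theorem exists_fin_enum (v : EuclideanSpace ℝ (Fin 3)) {t : Finset (EuclideanSpace ℝ (Fin 3))}
    (hv : v ∈ t) (hcard : (t.erase v).card = 3) :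
    ∃ p : Fin 3 → EuclideanSpace ℝ (Fin 3),
      insert v (Set.range p) = (↑t : Set (EuclideanSpace ℝ (Fin 3))) ∧
      apexCone v (fun i => p i - v) =
        apexCone v (fun w : ↥(t.erase v) => (↑w : EuclideanSpace ℝ (Fin 3)) - v) ∧
      (LinearIndependent ℝ (fun w : ↥(t.erase v) => (↑w : EuclideanSpace ℝ (Fin 3)) - v) →
        LinearIndependent ℝ (fun i => p i - v)) := by
  set f : ↥(t.erase v) ≃ Fin 3 := Finset.equivFinOfCardEq hcard
  refine ⟨fun i => ↑(f.symm i), ?_, ?_, fun hli => hli.comp f.symm f.symm.injective⟩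
  · have h1 : Set.range (fun i => (↑(f.symm i) : EuclideanSpace ℝ (Fin 3))) = ↑(t.erase v) := by
      ext x
      constructor
      · rintro ⟨i, rfl⟩
        exact ((f.symm i)).2
      · intro hx
        exact ⟨f ⟨x, hx⟩, by simp⟩
    rw [h1, ← Finset.coe_insert, Finset.insert_erase hv]
  · exact apexCone_comp_equiv v
      (fun w : ↥(t.erase v) => (↑w : EuclideanSpace ℝ (Fin 3)) - v) f.symm

/-- **Solid-angle flatness, finset form.**  For a finite set `S` of `4`-point sets `t ∋ v` of
`ℝ³` whose edge vectors at `v` are linearly independent, whose convex hulls have pairwise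
disjoint interiors and cover a ball about `v`, the unit-ball volume fractions at `v` of the
apex cones of the `t ∈ S` sum to `1` (the landed `solidAngleFlatness_proof`, reindexed).
[folklore] -/
theorem sum_ballFraction_apexCone_eq_one (v : EuclideanSpace ℝ (Fin 3))
    (S : Finset (Finset (EuclideanSpace ℝ (Fin 3))))
    (hv : ∀ t ∈ S, v ∈ t) (hcard : ∀ t ∈ S, (t.erase v).card = 3)
    (hli : ∀ t ∈ S,
      LinearIndependent ℝ (fun w : ↥(t.erase v) => (↑w : EuclideanSpace ℝ (Fin 3)) - v))
    (hdisj : ∀ s ∈ S, ∀ t ∈ S, s ≠ t →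
      Disjoint (interior (convexHull ℝ (↑s : Set (EuclideanSpace ℝ (Fin 3)))))
        (interior (convexHull ℝ (↑t : Set (EuclideanSpace ℝ (Fin 3))))))
    (hcov : ∃ r : ℝ, 0 < r ∧
      Metric.ball v r ⊆ ⋃ t ∈ S, convexHull ℝ (↑t : Set (EuclideanSpace ℝ (Fin 3)))) :
    ∑ t ∈ S, ballFraction v
      (apexCone v (fun w : ↥(t.erase v) => (↑w : EuclideanSpace ℝ (Fin 3)) - v)) = 1 := by
  choose P hP using fun t (ht : t ∈ S) => exists_fin_enum v (hv t ht) (hcard t ht)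
  -- enumerate `S` by `Fin S.card`
  let e : ↥S ≃ Fin S.card := S.equivFin
  have hli' : ∀ k : Fin S.card,
      LinearIndependent ℝ (fun i => P ↑(e.symm k) (e.symm k).2 i - v) :=
    fun k => (hP _ (e.symm k).2).2.2 (hli _ (e.symm k).2)
  have hdisj' : ∀ k l : Fin S.card, k ≠ l →
      interior (convexHull ℝ (insert v (Set.range (P ↑(e.symm k) (e.symm k).2)))) ∩
        interior (convexHull ℝ (insert v (Set.range (P ↑(e.symm l) (e.symm l).2)))) = ∅ := by
    intro k l hkl
    rw [(hP _ (e.symm k).2).1, (hP _ (e.symm l).2).1, ← Set.disjoint_iff_inter_eq_empty]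
    exact hdisj _ (e.symm k).2 _ (e.symm l).2 fun h => hkl (e.symm.injective (Subtype.ext h))
  obtain ⟨r, hr, hcov⟩ := hcov
  have hcover : ∃ r : ℝ, 0 < r ∧ Metric.ball v r ⊆
      ⋃ k : Fin S.card, convexHull ℝ (insert v (Set.range (P ↑(e.symm k) (e.symm k).2))) := by
    refine ⟨r, hr, fun x hx => ?_⟩
    obtain ⟨t, ht, hxt⟩ := Set.mem_iUnion₂.1 (hcov hx)
    have hk : x ∈ convexHull ℝ
        (insert v (Set.range (P ↑(e.symm (e ⟨t, ht⟩)) (e.symm (e ⟨t, ht⟩)).2))) := by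
      rw [Equiv.symm_apply_apply, (hP t ht).1]
      exact hxt
    exact Set.mem_iUnion.2 ⟨e ⟨t, ht⟩, hk⟩
  have h := (solidAngleFlatness_proof S.card v (fun k => P ↑(e.symm k) (e.symm k).2)
    hli' hdisj').2 hcover
  calc ∑ t ∈ S, ballFraction v
        (apexCone v (fun w : ↥(t.erase v) => (↑w : EuclideanSpace ℝ (Fin 3)) - v))
      = ∑ s : ↥S, ballFraction v
          (apexCone v (fun w : ↥((↑s : Finset (EuclideanSpace ℝ (Fin 3))).erase v) =>
            (↑w : EuclideanSpace ℝ (Fin 3)) - v)) := (Finset.sum_coe_sort S _).symm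
    _ = ∑ k : Fin S.card, ballFraction v
          (apexCone v (fun i => P ↑(e.symm k) (e.symm k).2 i - v)) :=
        (Fintype.sum_equiv e.symm _ _ fun k =>
          congrArg (ballFraction v) (hP _ (e.symm k).2).2.1).symm
    _ = 1 := h

/-- **Solid-angle partition of unity at an interior vertex, complex form** (stub
`stub_vertexFlat` of line `Sketch`, crux `SquareWellLayerCake.AveragedTwelve`).  In a
triangulation `K` of a finite `ω ⊂ ℝ³`, at a site `v` interior to `conv ω` the unit-ball volume
fractions at `v` of the apex cones of the cells (`4`-vertex simplices of `K`) through `v` sum to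
`1`. [folklore] -/
theorem stub_vertexFlat : ∀ (ω : Finset (EuclideanSpace ℝ (Fin 3))) (K : Geometry.SimplicialComplex ℝ (EuclideanSpace ℝ (Fin 3))), Literature.Geometry.DiscreteGeometry.IsTriangulation (↑ω : Set (EuclideanSpace ℝ (Fin 3))) K → ∀ v ∈ ω, v ∈ interior (convexHull ℝ (↑ω : Set (EuclideanSpace ℝ (Fin 3)))) → ∀ (S : Finset (Finset (EuclideanSpace ℝ (Fin 3)))), (∀ t, t ∈ S ↔ t ∈ K.faces ∧ v ∈ t ∧ t.card = 4) → ∑ t ∈ S, Literature.Geometry.DiscreteGeometry.ballFraction v (Literature.Geometry.DiscreteGeometry.apexCone v (fun w : ↥((t).erase v) => (↑w : EuclideanSpace ℝ (Fin 3)) - v)) = 1 := by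
  intro ω K hK v hv hint S hS
  have h4 : Module.finrank ℝ (EuclideanSpace ℝ (Fin 3)) + 1 = 4 := by
    rw [finrank_euclideanSpace_fin]
  have hstar : ∀ t, t ∈ S ↔ t ∈ vertexStar K v := fun t => by
    rw [hS t, mem_vertexStar, h4]
  refine sum_ballFraction_apexCone_eq_one v S (fun t ht => ((hS t).1 ht).2.1)
    (fun t ht => ?_) (fun t ht => ?_) (fun s hs t ht hst => ?_) ?_
  · rw [Finset.card_erase_of_mem ((hS t).1 ht).2.1, ((hS t).1 ht).2.2]
  · exact linearIndependent_sub_of_mem_faces ((hS t).1 ht).1 ((hS t).1 ht).2.1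
  · exact disjoint_interior_of_mem_vertexStar ((hstar s).1 hs) ((hstar t).1 ht) hst
  · obtain ⟨r, hr, hcov⟩ := hK.exists_ball_subset_biUnion_vertexStar ω.finite_toSet hv hint
    refine ⟨r, hr, fun x hx => ?_⟩
    obtain ⟨t, ht, hxt⟩ := Set.mem_iUnion₂.1 (hcov hx)
    exact Set.mem_iUnion₂.2 ⟨t, (hstar t).2 ht, hxt⟩

end Summit.AtomisticToContinuum.Crystallization.Theorems.ParFiveRecountVertexFlat

end
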